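import Mathlib
import Literature.AlgebraicGeometry.HodgeTheory.FermatHodgeCharacters
import Literature.AlgebraicGeometry.HodgeTheory.FermatShiodaCondition
import HarnessLib

/-!
# Fermat cycles — the complete-intersection families `Z_AB(n), Z_CD(n) ⊂ X⁴_{6n}` and the sporadic `Z₁₁ ⊂ X⁴₅₆`
(cell `pub-hfermat`, search-1 Hits 11–14)

HONEST FRAMING: explicit algebraic cycles for specific Hodge classes on Fermat/Delsarte varieties;
residual open instances listed; no claim on general Hodge.

Companion to `ExplicitE3Family`.  The cell's unit `search-1` (gen-3) exhibits further complete-intersection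
surfaces on Fermat fourfolds, obtained by running Shioda's inductive structure [Shioda1979HodgeFermat, Thm II, Lemma 3]
forwards on Aoki–Shioda curves [AokiShioda1983, Thms 1–3] and eliminating the auxiliary coordinates:

* for every `n` (degree `m = 6n`), `Z_AB(n) = V(E₁, E₂, E₃) ⊂ X⁴_{6n}`, multidegree `(2n, 6, 3n)`:
  `E₁ = x_e^{2n} + α(x_a x_b)^n + β(x_c x_d)^n`, `E₂ = x_f⁶ − κ·x_a x_b x_c x_d x_e²`,
  `E₃ = x_c^{3n} + x_d^{3n} + i(x_a^{3n} + x_b^{3n})`, constants with `α³ = β³ = −2`, `κⁿ = −3αβ`, `i² = −1`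
  (coordinates `(x_a,x_b,x_c,x_d,x_e,x_f)` ↔ character values `(1, 1+3n, 1+2n, 1+5n, 2+2n, −6)` resp.
  `(1, 1+3n, 1+n, 1+4n, 2+4n, −6)`; `n = 8` is the cell's Hit 12, target `(1,17,18,25,41,42)` on `X⁴₄₈`);
* for every `n`, `Z_CD(n) = V(E₁′, E₂′, E₃) ⊂ X⁴_{6n}`, multidegree `(2n, 6, 3n)`:
  `E₁′ = x_p^{2n} + x_q^{2n} + β(x_c x_d)^n`, `E₂′ = (x_a x_b)³ − ν·x_c x_d x_p² x_q²`, `E₃` as above,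
  `β³ = −2`, `2νⁿ = 3β`, `i² = −1` (coordinates `(x_a,x_b,x_c,x_d,x_p,x_q)` ↔ `(3n−3, 6n−3, 1+n, 1+4n, 2, 2+4n)` resp.
  `(3n−3, 6n−3, 1+2n, 1+5n, 2, 2+2n)`; `n = 8` is Hit 13, target `(2,9,21,33,34,45)` on `X⁴₄₈`);
* `Z₁₁ = V(R₂, R_W, R₃) ⊂ X⁴₅₆`, multidegree `(28, 28, 28)` (Hit 11, target `(1,15,29,36,43,44)`):
  `R₂ = K₃²M₁⁴M₃⁴x₃⁴x₅⁸ + x₃²⁸ − s·K₃M₁²M₃²x₃¹⁶x₅⁴ + i·x₅²⁸`,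
  `R_W = c(M₁¹⁴ + M₃¹⁴) − s·c(M₁M₃)⁷ + i·K₂M₁M₃x₃⁸x₅¹⁶`, `R₃ = x₀²⁸ + x₂²⁸ − i(x₁²⁸ + x₄²⁸)`
  (`M₁ = x₀x₂`, `M₃ = x₁x₄`; `i² = −1`, `s² = 2`, `c² = 2`, `K₂² = 2siK₃`, `K₃⁴ = 2sicK₂`; over `ℚ(ζ₅₆, 2^{1/28})`
  take `c = c₁¹⁴`, `K₂ = c₃¹⁰c₁²`, `K₃ = K₂²/c₃¹⁴` with `c₁²⁸ = 2`, `c₃²⁸ = −8`, `c₃¹⁴ = 2si`).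

What is KERNEL-CHECKED here (and nothing more): the polynomial identities `Σ_j x_j^m = Σ_k E_k g_k` with explicit
cofactors, in every commutative ring containing constants with the stated relations (uniformly in `n` for the two
families) — i.e. each surface lies on its Fermat fourfold — in the input format of [Villaflor2022PeriodsCI, Thm 2];
and that the characters `(1,17,18,25,41,42)`, `(2,9,21,33,34,45)` (`m = 48`) and `(1,15,29,36,43,44)` (`m = 56`) are
Hodge characters (Shioda's criterion, kernel decision).

What is NOT formalised (in the cell, two independent implementations — the block recipe and Villaflor Loyola periods
mod p — agreeing on every primitive character, files `run/shared/lean/pub/pub-hfermat/pub-hfermat-search-1/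
CANCEL-EXPLICIT.md` §4.9–4.12, `out/cx/z56b_p*.json`, `z48b_p*.json`, `z48c_p*.json`, `famscan_*.json`): the periods
`∫_Z ω_b` are non-zero at every unit multiple of the target characters, so the corresponding eigenlines — census grade
"E3" (algebraic only through Shioda's inductive structure, no constructible cycle previously recorded) at
`m = 36, 48, 54, 66, 72, …` for the families and at `m = 56` for `Z₁₁` — are spanned by classes of explicit cycles
`g·Z`, `g ∈ μ_m⁶`.

References: [Shioda1979HodgeFermat] T. Shioda, The Hodge conjecture for Fermat varieties, Math. Ann. 245 (1979)
175–184; [AokiShioda1983] N. Aoki, T. Shioda, Generators of the Néron–Severi group of a Fermat surface, Progr. Math.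
35 (1983) 1–12; [Villaflor2022PeriodsCI] R. Villaflor Loyola, Periods of complete intersection algebraic cycles,
manuscripta math. 167 (2022) 765–792, Thm 2.
-/

open Finset
open Literature.AlgebraicGeometry.HodgeTheory Literature.AlgebraicGeometry.HodgeTheory.FermatCharacter

namespace Summit.HodgeConjecture.FermatCycles.ExplicitE3Sporadic

section Ideal

variable {R : Type*} [CommRing R]

/-! ### The family `Z_AB(n) ⊂ X⁴_{6n}` (Hit 12 is `n = 8`; multidegree `(2n, 6, 3n)`) -/

/-- `E₁ = x_e^{2n} + α(x_a x_b)^n + β(x_c x_d)^n`. [folklore] -/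
def eOne (n : ℕ) (al be xa xb xc xd xe : R) : R := xe ^ (2 * n) + al * (xa * xb) ^ n + be * (xc * xd) ^ n

/-- Cofactor of `E₁`: the quadratic factor of `X³ + Y³ + Z³ − 3XYZ`. [folklore] -/
def gEOne (n : ℕ) (al be xa xb xc xd xe : R) : R :=
  (xe ^ (2 * n)) ^ 2 + (al * (xa * xb) ^ n) ^ 2 + (be * (xc * xd) ^ n) ^ 2 - xe ^ (2 * n) * (al * (xa * xb) ^ n)
    - xe ^ (2 * n) * (be * (xc * xd) ^ n) - (al * (xa * xb) ^ n) * (be * (xc * xd) ^ n)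

/-- `E₂ = x_f⁶ − κ x_a x_b x_c x_d x_e²`. [folklore] -/
def eTwo (kap xa xb xc xd xe xf : R) : R := xf ^ 6 - kap * (xa * xb * xc * xd * xe ^ 2)

/-- Cofactor of `E₂` (geometric sum). [folklore] -/
def gETwo (n : ℕ) (kap xa xb xc xd xe xf : R) : R :=
  ∑ j ∈ range n, (xf ^ 6) ^ j * (kap * (xa * xb * xc * xd * xe ^ 2)) ^ (n - 1 - j)

/-- `E₃ = x_c^{3n} + x_d^{3n} + i(x_a^{3n} + x_b^{3n})`. [folklore] -/
def eThree (n : ℕ) (I xa xb xc xd : R) : R := xc ^ (3 * n) + xd ^ (3 * n) + I * (xa ^ (3 * n) + xb ^ (3 * n))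

/-- Cofactor of `E₃`. [folklore] -/
def gEThree (n : ℕ) (I xa xb xc xd : R) : R := xc ^ (3 * n) + xd ^ (3 * n) - I * (xa ^ (3 * n) + xb ^ (3 * n))

/-- `E₂·g₂ = x_f^{6n} − κⁿ(x_a x_b x_c x_d x_e²)ⁿ` (telescoping). [folklore] -/
theorem eTwo_mul_gETwo (n : ℕ) (kap xa xb xc xd xe xf : R) :
    eTwo kap xa xb xc xd xe xf * gETwo n kap xa xb xc xd xe xf
      = xf ^ (6 * n) - kap ^ n * (xa * xb * xc * xd * xe ^ 2) ^ n := by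
  have h := (Commute.all (xf ^ 6) (kap * (xa * xb * xc * xd * xe ^ 2))).geom_sum₂_mul n
  unfold eTwo gETwo
  rw [mul_comm, h, ← pow_mul, mul_pow]

/-- `Σ_j x_j^{6n} = E₁g₁ + E₂g₂ + E₃g₃`: the surface `Z_AB(n)` lies on the Fermat fourfold `X⁴_{6n}`, for every `n`
and all constants with `α³ = β³ = −2`, `κⁿ = −3αβ`, `i² = −1`. [folklore] -/
theorem fermat6n_eq_combination (n : ℕ) (I al be kap xa xb xc xd xe xf : R)
    (hI : I ^ 2 = -1) (hal : al ^ 3 = -2) (hbe : be ^ 3 = -2) (hkap : kap ^ n = -3 * al * be) :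
    xa ^ (6 * n) + xb ^ (6 * n) + xc ^ (6 * n) + xd ^ (6 * n) + xe ^ (6 * n) + xf ^ (6 * n)
      = eOne n al be xa xb xc xd xe * gEOne n al be xa xb xc xd xe
        + eTwo kap xa xb xc xd xe xf * gETwo n kap xa xb xc xd xe xf
        + eThree n I xa xb xc xd * gEThree n I xa xb xc xd := by
  rw [eTwo_mul_gETwo]
  unfold eOne gEOne eThree gEThree
  have e1 : ∀ y : R, y ^ (6 * n) = (y ^ n) ^ 6 := fun y => by rw [← pow_mul, mul_comm]
  have e2 : ∀ y : R, y ^ (3 * n) = (y ^ n) ^ 3 := fun y => by rw [← pow_mul, mul_comm]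
  have e3 : ∀ y : R, y ^ (2 * n) = (y ^ n) ^ 2 := fun y => by rw [← pow_mul, mul_comm]
  rw [e1, e1, e1, e1, e1, e1, e2, e2, e2, e2, e3, mul_pow, mul_pow, mul_pow, mul_pow, mul_pow, mul_pow, ← pow_mul,
    hkap]
  linear_combination ((xa ^ n) ^ 3 + (xb ^ n) ^ 3) ^ 2 * hI - (xa ^ n * xb ^ n) ^ 3 * hal
    - (xc ^ n * xd ^ n) ^ 3 * hbe

/-- Ideal-membership form for `Z_AB(n)`. [folklore] -/
theorem fermat6n_mem_span (n : ℕ) (I al be kap xa xb xc xd xe xf : R)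
    (hI : I ^ 2 = -1) (hal : al ^ 3 = -2) (hbe : be ^ 3 = -2) (hkap : kap ^ n = -3 * al * be) :
    xa ^ (6 * n) + xb ^ (6 * n) + xc ^ (6 * n) + xd ^ (6 * n) + xe ^ (6 * n) + xf ^ (6 * n)
      ∈ Ideal.span ({eOne n al be xa xb xc xd xe, eTwo kap xa xb xc xd xe xf, eThree n I xa xb xc xd} : Set R) := by
  rw [fermat6n_eq_combination n I al be kap xa xb xc xd xe xf hI hal hbe hkap]
  refine Ideal.add_mem _ (Ideal.add_mem _ ?_ ?_) ?_
  · exact Ideal.mul_mem_right _ _ (Ideal.subset_span (by simp))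
  · exact Ideal.mul_mem_right _ _ (Ideal.subset_span (by simp))
  · exact Ideal.mul_mem_right _ _ (Ideal.subset_span (by simp))

/-! ### The family `Z_CD(n) ⊂ X⁴_{6n}` (Hit 13 is `n = 8`; multidegree `(2n, 6, 3n)`) -/

/-- `E₁′ = x_p^{2n} + x_q^{2n} + β(x_c x_d)^n`. [folklore] -/
def eOne' (n : ℕ) (be xc xd xp xq : R) : R := xp ^ (2 * n) + xq ^ (2 * n) + be * (xc * xd) ^ n

/-- Cofactor of `E₁′`. [folklore] -/
def gEOne' (n : ℕ) (be xc xd xp xq : R) : R :=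
  (xp ^ (2 * n)) ^ 2 + (xq ^ (2 * n)) ^ 2 + (be * (xc * xd) ^ n) ^ 2 - xp ^ (2 * n) * xq ^ (2 * n)
    - xp ^ (2 * n) * (be * (xc * xd) ^ n) - xq ^ (2 * n) * (be * (xc * xd) ^ n)

/-- `E₂′ = (x_a x_b)³ − ν x_c x_d x_p² x_q²`. [folklore] -/
def eTwo' (nu xa xb xc xd xp xq : R) : R := (xa * xb) ^ 3 - nu * (xc * xd * xp ^ 2 * xq ^ 2)

/-- Cofactor of `E₂′`: `−2 ×` geometric sum. [folklore] -/
def gETwo' (n : ℕ) (nu xa xb xc xd xp xq : R) : R :=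
  -2 * ∑ j ∈ range n, ((xa * xb) ^ 3) ^ j * (nu * (xc * xd * xp ^ 2 * xq ^ 2)) ^ (n - 1 - j)

/-- `E₂′·g₂′ = −2((x_a x_b)^{3n} − νⁿ(x_c x_d x_p² x_q²)ⁿ)` (telescoping). [folklore] -/
theorem eTwo'_mul_gETwo' (n : ℕ) (nu xa xb xc xd xp xq : R) :
    eTwo' nu xa xb xc xd xp xq * gETwo' n nu xa xb xc xd xp xq
      = -2 * (((xa * xb) ^ 3) ^ n - (nu * (xc * xd * xp ^ 2 * xq ^ 2)) ^ n) := by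
  have h := (Commute.all ((xa * xb) ^ 3) (nu * (xc * xd * xp ^ 2 * xq ^ 2))).geom_sum₂_mul n
  unfold eTwo' gETwo'
  have e : ((xa * xb) ^ 3 - nu * (xc * xd * xp ^ 2 * xq ^ 2))
      * (-2 * ∑ j ∈ range n, ((xa * xb) ^ 3) ^ j * (nu * (xc * xd * xp ^ 2 * xq ^ 2)) ^ (n - 1 - j))
      = -2 * ((∑ j ∈ range n, ((xa * xb) ^ 3) ^ j * (nu * (xc * xd * xp ^ 2 * xq ^ 2)) ^ (n - 1 - j))
          * ((xa * xb) ^ 3 - nu * (xc * xd * xp ^ 2 * xq ^ 2))) := by ring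
  rw [e, h]

/-- `Σ_j x_j^{6n} = E₁′g₁′ + E₂′g₂′ + E₃g₃` for `Z_CD(n)`, for every `n` and all constants with `β³ = −2`,
`2νⁿ = 3β`, `i² = −1`. [folklore] -/
theorem fermat6n'_eq_combination (n : ℕ) (I be nu xa xb xc xd xp xq : R)
    (hI : I ^ 2 = -1) (hbe : be ^ 3 = -2) (hnu : 2 * nu ^ n = 3 * be) :
    xa ^ (6 * n) + xb ^ (6 * n) + xc ^ (6 * n) + xd ^ (6 * n) + xp ^ (6 * n) + xq ^ (6 * n)
      = eOne' n be xc xd xp xq * gEOne' n be xc xd xp xq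
        + eTwo' nu xa xb xc xd xp xq * gETwo' n nu xa xb xc xd xp xq
        + eThree n I xa xb xc xd * gEThree n I xa xb xc xd := by
  rw [eTwo'_mul_gETwo']
  unfold eOne' gEOne' eThree gEThree
  have e1 : ∀ y : R, y ^ (6 * n) = (y ^ n) ^ 6 := fun y => by rw [← pow_mul, mul_comm]
  have e2 : ∀ y : R, y ^ (3 * n) = (y ^ n) ^ 3 := fun y => by rw [← pow_mul, mul_comm]
  have e3 : ∀ y : R, y ^ (2 * n) = (y ^ n) ^ 2 := fun y => by rw [← pow_mul, mul_comm]
  have e4 : ((xa * xb) ^ 3) ^ n = (xa ^ n) ^ 3 * (xb ^ n) ^ 3 := by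
    rw [← pow_mul, mul_pow, mul_comm 3 n, pow_mul, pow_mul]
  have e5 : (nu * (xc * xd * xp ^ 2 * xq ^ 2)) ^ n = nu ^ n * (xc ^ n * xd ^ n * (xp ^ n) ^ 2 * (xq ^ n) ^ 2) := by
    rw [mul_pow, mul_pow, mul_pow, mul_pow, ← pow_mul xp, ← pow_mul xq, mul_comm 2 n, pow_mul, pow_mul]
  have e6 : (xc * xd) ^ n = xc ^ n * xd ^ n := mul_pow _ _ _
  simp only [e1, e2, e3, e4, e5, e6]
  linear_combination ((xa ^ n) ^ 3 + (xb ^ n) ^ 3) ^ 2 * hI - (xc ^ n * xd ^ n) ^ 3 * hbe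
    - (xp ^ n) ^ 2 * (xq ^ n) ^ 2 * (xc ^ n * xd ^ n) * hnu

/-- Ideal-membership form for `Z_CD(n)`. [folklore] -/
theorem fermat6n'_mem_span (n : ℕ) (I be nu xa xb xc xd xp xq : R)
    (hI : I ^ 2 = -1) (hbe : be ^ 3 = -2) (hnu : 2 * nu ^ n = 3 * be) :
    xa ^ (6 * n) + xb ^ (6 * n) + xc ^ (6 * n) + xd ^ (6 * n) + xp ^ (6 * n) + xq ^ (6 * n)
      ∈ Ideal.span ({eOne' n be xc xd xp xq, eTwo' nu xa xb xc xd xp xq, eThree n I xa xb xc xd} : Set R) := by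
  rw [fermat6n'_eq_combination n I be nu xa xb xc xd xp xq hI hbe hnu]
  refine Ideal.add_mem _ (Ideal.add_mem _ ?_ ?_) ?_
  · exact Ideal.mul_mem_right _ _ (Ideal.subset_span (by simp))
  · exact Ideal.mul_mem_right _ _ (Ideal.subset_span (by simp))
  · exact Ideal.mul_mem_right _ _ (Ideal.subset_span (by simp))

/-! ### `Z₁₁ ⊂ X⁴₅₆` -/

/-- `R₂ = K₃²M₁⁴M₃⁴x₃⁴x₅⁸ + x₃²⁸ − sK₃M₁²M₃²x₃¹⁶x₅⁴ + i x₅²⁸` (`M₁ = x₀x₂`, `M₃ = x₁x₄`). [folklore] -/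
def rTwo (I s K3 x0 x1 x2 x3 x4 x5 : R) : R :=
  K3 ^ 2 * (x0 * x2) ^ 4 * (x1 * x4) ^ 4 * x3 ^ 4 * x5 ^ 8 + x3 ^ 28
    - s * K3 * (x0 * x2) ^ 2 * (x1 * x4) ^ 2 * x3 ^ 16 * x5 ^ 4 + I * x5 ^ 28

/-- Cofactor of `R₂`. [folklore] -/
def gRTwo (I s K3 x0 x1 x2 x3 x4 x5 : R) : R :=
  K3 ^ 2 * (x0 * x2) ^ 4 * (x1 * x4) ^ 4 * x3 ^ 4 * x5 ^ 8 + x3 ^ 28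
    + s * K3 * (x0 * x2) ^ 2 * (x1 * x4) ^ 2 * x3 ^ 16 * x5 ^ 4 - I * x5 ^ 28

/-- `R_W = c(M₁¹⁴ + M₃¹⁴) − sc(M₁M₃)⁷ + iK₂M₁M₃x₃⁸x₅¹⁶`. [folklore] -/
def rW (I s c K2 x0 x1 x2 x3 x4 x5 : R) : R :=
  c * ((x0 * x2) ^ 14 + (x1 * x4) ^ 14) - s * c * ((x0 * x2) * (x1 * x4)) ^ 7
    + I * K2 * (x0 * x2) * (x1 * x4) * x3 ^ 8 * x5 ^ 16

/-- Cofactor of `R_W`. [folklore] -/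
def gRW (I s c K2 x0 x1 x2 x3 x4 x5 : R) : R :=
  -(c * ((x0 * x2) ^ 14 + (x1 * x4) ^ 14) + s * c * ((x0 * x2) * (x1 * x4)) ^ 7
    - I * K2 * (x0 * x2) * (x1 * x4) * x3 ^ 8 * x5 ^ 16)

/-- `R₃ = x₀²⁸ + x₂²⁸ − i(x₁²⁸ + x₄²⁸)`. [folklore] -/
def rThree (I x0 x1 x2 x4 : R) : R := x0 ^ 28 + x2 ^ 28 - I * (x1 ^ 28 + x4 ^ 28)

/-- Cofactor of `R₃`. [folklore] -/
def gRThree (I x0 x1 x2 x4 : R) : R := x0 ^ 28 + x2 ^ 28 + I * (x1 ^ 28 + x4 ^ 28)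

/-- `Σ_j x_j⁵⁶ = R₂g₂ + R_Wg_W + R₃g₃` for `Z₁₁`: the surface lies on the Fermat fourfold `X⁴₅₆`. [folklore] -/
theorem fermat56_eq_combination (I s c K2 K3 x0 x1 x2 x3 x4 x5 : R)
    (hI : I ^ 2 = -1) (hs : s ^ 2 = 2) (hc : c ^ 2 = 2) (hK2 : K2 ^ 2 = 2 * s * I * K3)
    (hK3 : K3 ^ 4 = 2 * s * I * c * K2) :
    x0 ^ 56 + x1 ^ 56 + x2 ^ 56 + x3 ^ 56 + x4 ^ 56 + x5 ^ 56
      = rTwo I s K3 x0 x1 x2 x3 x4 x5 * gRTwo I s K3 x0 x1 x2 x3 x4 x5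
        + rW I s c K2 x0 x1 x2 x3 x4 x5 * gRW I s c K2 x0 x1 x2 x3 x4 x5
        + rThree I x0 x1 x2 x4 * gRThree I x0 x1 x2 x4 := by
  unfold rTwo gRTwo rW gRW rThree gRThree
  linear_combination
    (x5 ^ 56 - (K2 * (x0 * x2) * (x1 * x4) * x3 ^ 8 * x5 ^ 16) ^ 2 + (x1 ^ 28 + x4 ^ 28) ^ 2) * hI
    + (K3 ^ 2 * (x0 * x2) ^ 4 * (x1 * x4) ^ 4 * x3 ^ 4 * x5 ^ 8 * x3 ^ 28
        - c ^ 2 * ((x0 * x2) * (x1 * x4)) ^ 14) * hs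
    + ((x0 * x2) ^ 28 + (x1 * x4) ^ 28) * hc
    + (x0 * x2) ^ 2 * (x1 * x4) ^ 2 * x3 ^ 16 * x5 ^ 32 * hK2
    - (x0 * x2) ^ 8 * (x1 * x4) ^ 8 * x3 ^ 8 * x5 ^ 16 * hK3

/-- Ideal-membership form for `Z₁₁`. [folklore] -/
theorem fermat56_mem_span (I s c K2 K3 x0 x1 x2 x3 x4 x5 : R)
    (hI : I ^ 2 = -1) (hs : s ^ 2 = 2) (hc : c ^ 2 = 2) (hK2 : K2 ^ 2 = 2 * s * I * K3)
    (hK3 : K3 ^ 4 = 2 * s * I * c * K2) :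
    x0 ^ 56 + x1 ^ 56 + x2 ^ 56 + x3 ^ 56 + x4 ^ 56 + x5 ^ 56
      ∈ Ideal.span ({rTwo I s K3 x0 x1 x2 x3 x4 x5, rW I s c K2 x0 x1 x2 x3 x4 x5, rThree I x0 x1 x2 x4} : Set R) := by
  rw [fermat56_eq_combination I s c K2 K3 x0 x1 x2 x3 x4 x5 hI hs hc hK2 hK3]
  refine Ideal.add_mem _ (Ideal.add_mem _ ?_ ?_) ?_
  · exact Ideal.mul_mem_right _ _ (Ideal.subset_span (by simp))
  · exact Ideal.mul_mem_right _ _ (Ideal.subset_span (by simp))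
  · exact Ideal.mul_mem_right _ _ (Ideal.subset_span (by simp))

end Ideal

section Characters

/-- Target character of `Z₁₂`: `(1,17,18,25,41,42)` on `X⁴₄₈` (grade E3 in the cell's census). [folklore] -/
def delta48a : Fin (2 * 2 + 2) → ZMod 48 := ![1, 17, 18, 25, 41, 42]

/-- Target character of `Z₁₃`: `(2,9,21,33,34,45)` on `X⁴₄₈` (grade E3). [folklore] -/
def delta48b : Fin (2 * 2 + 2) → ZMod 48 := ![2, 9, 21, 33, 34, 45]

/-- Target character of `Z₁₁`: `(1,15,29,36,43,44)` on `X⁴₅₆` (grade E3). [folklore] -/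
def delta56 : Fin (2 * 2 + 2) → ZMod 56 := ![1, 15, 29, 36, 43, 44]

/-- `(1,17,18,25,41,42)` is a Hodge character of `X⁴₄₈` (Shioda's criterion). [cite: Shioda1979HodgeFermat, Thm I] -/
theorem isHodge_delta48a : IsHodge delta48a := by
  refine (isHodge_iff_isHodgeMultiset _).2 ?_
  unfold IsHodgeMultiset mNormSum delta48a
  decide +kernel

/-- `(2,9,21,33,34,45)` is a Hodge character of `X⁴₄₈`. [cite: Shioda1979HodgeFermat, Thm I] -/
theorem isHodge_delta48b : IsHodge delta48b := by
  refine (isHodge_iff_isHodgeMultiset _).2 ?_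
  unfold IsHodgeMultiset mNormSum delta48b
  decide +kernel

/-- `(1,15,29,36,43,44)` is a Hodge character of `X⁴₅₆`. [cite: Shioda1979HodgeFermat, Thm I] -/
theorem isHodge_delta56 : IsHodge delta56 := by
  refine (isHodge_iff_isHodgeMultiset _).2 ?_
  unfold IsHodgeMultiset mNormSum delta56
  decide +kernel

end Characters

end Summit.HodgeConjecture.FermatCycles.ExplicitE3Sporadic
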